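import Summits.BirchSwinnertonDyer.BirchSwinnertonDyer.Theorems.PrintCf2RubinValueTwoColemanCoinvariantCharTraceSandwich
import Literature.NumberTheory.EllipticCurves.IwasawaAlgebraCharIdealIdealSandwichProofs
import HarnessLib

/-!
# Brick (c) at `p = 2`, local `χ`-part: THE SANDWICH ON THE TRACE WITH HEIGHT-TWO IDEALS — two closed `Γ_F`-stable subgroups `C₁, C₂ ⊆ 𝒰¹_∞` whose Coleman
# ideals satisfy `J₁·I₁ ⊆ I₂`, `2^k·J₂·I₂ ⊆ I₁` for ideals `J₁, J₂` with `Λ/J_i` pseudo-null have `char_Λ((N_Σ/Col_Σ C₂)_ε)·(2)^i = char_Λ((N_Σ/Col_Σ C₁)_ε)·(2)^{i′}`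

Cell `bsd-print-cf2`, width seat `bsd-line-cf2c-w7` g26, route C `PrintCf2RubinValueTwo`, crux of record stmt-BirchSwinnertonDyer-24033
`TwoVariableMainConjAtSplitTwoQuad` (23720 nominal), BRICK §4(c), item D4χ (`BrickCD4Chi.BrickCD4ChiClosureComparison`); `--supports` the crux as a helper.
The ideal form of `PrintCf2RubinValueTwoColemanCoinvariantCharTraceSandwich.lean` (p820233, prime PAIRS): the product-rule trick for the liftable `𝔞` outside Robert's
index convention produces a height-two IDEAL `J = (T, C X)·(t_{χ(σ̃_𝔠)}·C g_𝔠 − N𝔠)_𝔠` rather than a prime pair (`…BrickCD4ChiRuleTransfer`, `…FirstPairCoprime`), and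
ideals compose under products (`Module.isPseudoNull_quotient_mul`); the algebra is `Module.exists_charIdeal_quotient_mul_span_pow_eq_of_ideal_sandwich` (p822025).

* ★★★ `exists_charIdeal_coinvariants_colemanImageTrace_mul_span_two_pow_eq_of_ideal_sandwich`.
THEOREMS ONLY (0 sorry, no new definitions, no named-fact hypotheses).  BSD is not proved by any of this; nothing here closes 24033.

## References
* [deShalit1987] E. de Shalit, *Iwasawa theory of elliptic curves with complex multiplication* (1987), III §1.3–1.4 (5), §1.8 (14)–(15), Lemma 1.10 (17); II §4.12.
* [Washington1997] L. C. Washington, *Introduction to Cyclotomic Fields* (1997), §13.2.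
* [BourbakiAC5to7] N. Bourbaki, *Commutative Algebra* Ch. VII §4 no. 5.
-/

noncomputable section

set_option linter.dupNamespace false
set_option autoImplicit false

open Filter Topology
open scoped PowerSeries.WithPiTopology

namespace Summit.BirchSwinnertonDyer.BirchSwinnertonDyer.Theorems.PrintCf2.ColemanCoinvariantTraceSandwich

open Literature.NumberTheory.GaloisRepresentations Literature.NumberTheory.GaloisRepresentations.IsNonarchimedeanLocalField
  Literature.NumberTheory.GaloisRepresentations.LubinTate ValuativeRel Field
open Literature.NumberTheory.EllipticCurves
open Summit.BirchSwinnertonDyer.BirchSwinnertonDyer.Theorems.PrintCf2.ColemanImage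
open Summit.BirchSwinnertonDyer.BirchSwinnertonDyer.Theorems.PrintCf2.ColemanCoinvariantTrace

variable {F : Type} [Field F] [ValuativeRel F] [TopologicalSpace F] [IsNonarchimedeanLocalField F]

attribute [local instance] ltNormUniformSpace ltNormIsUniformAddGroup rk1 nF nE fintypeResidueField
attribute [local instance] RelNormCoherentUnits.instCommMonoid
attribute [local instance] isAdicComplete_maximalIdeal_powerSeries_integer

/-! ## The ideal sandwich on the trace -/

variable {p : ℕ} [hp : Fact p.Prime] {d : ℕ} (hd : d.Coprime p)
variable {π : 𝒪[F]} (hπ : (valuation F).IsUniformizer (π : F))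
variable (E : ℕ → IntermediateField F (AlgebraicClosure F)) [∀ m, FiniteDimensional F (E m)] [∀ m, Normal F (E m)]
  [∀ m, IsGalois F (E m)] (hmono : Monotone E) (hE : ∀ m, E m ≤ maxUnramified F) (hdeg : ∀ m, Module.finrank F (E m) = d * p ^ m)
  {σ₀ : absoluteGaloisGroup F} (hσ₀ : IsAbsArithFrob σ₀) (hq : residueFieldCard F = 2)
variable (u : (LTCoeff F)ˣ) (hu : LTCoeff.of F π = residueFieldCard F * u) (γ w : 𝒪[F]ˣ) (hγ : (γ : 𝒪[F]) = 1 + π ^ 2 * w)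
variable [IsAdicComplete (Ideal.span {intBase F (LTCoeff.of F π)}) (PowerSeries 𝒪[F])] [NeZero d]
variable {θ : ∀ m, unitBall (E m)} (hθ : ∀ m, IsIntegralNormalGen (E m) (θ m))
  (hcoh : ∀ m, unitBallTrace (hmono (Nat.le_succ m)) (θ (m + 1)) = θ m)
variable [CharZero F] [IsAdicComplete (Ideal.span {(p : 𝒪[F])}) 𝒪[F]] (hI : Ideal.span {(p : 𝒪[F])} ≠ ⊤)
  (hud : ∀ m, (u : LTCoeff F) ^ Module.finrank F (E m) ≠ 1) (hm : ∃ m₁ : ℕ, LTCoeff.of F π ^ 2 ∣ LTCoeff.of F π - m₁)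
  (hN : DenseRange (Nat.cast : ℕ → 𝒪[F]))
  (C₁ : Set (∀ m, RelNormCoherentUnits hπ (E m))) (hC₁ : IsClosed C₁) (hC₁sub : C₁ ⊆ principalCoherentFamilies hπ E hmono)
  (h1₁ : (fun m => (RelNormCoherentUnits.one : RelNormCoherentUnits hπ (E m))) ∈ C₁)
  (hmul₁ : ∀ β ∈ C₁, ∀ β' ∈ C₁, (fun m => (β m).mul (β' m)) ∈ C₁) (hinv₁ : ∀ β ∈ C₁, (fun m => (β m).inv hπ (E m)) ∈ C₁)
  (hgal₁ : ∀ σ : absoluteGaloisGroup F, ∀ β ∈ C₁, (fun m => (β m).galAct σ) ∈ C₁)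
  (C₂ : Set (∀ m, RelNormCoherentUnits hπ (E m))) (hC₂ : IsClosed C₂) (hC₂sub : C₂ ⊆ principalCoherentFamilies hπ E hmono)
  (h1₂ : (fun m => (RelNormCoherentUnits.one : RelNormCoherentUnits hπ (E m))) ∈ C₂)
  (hmul₂ : ∀ β ∈ C₂, ∀ β' ∈ C₂, (fun m => (β m).mul (β' m)) ∈ C₂) (hinv₂ : ∀ β ∈ C₂, (fun m => (β m).inv hπ (E m)) ∈ C₂)
  (hgal₂ : ∀ σ : absoluteGaloisGroup F, ∀ β ∈ C₂, (fun m => (β m).galAct σ) ∈ C₂)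

include hE hdeg hσ₀ hcoh hm in
/-- ★★★ **THE IDEAL SANDWICH ON THE TRACE.**  Let `C₁, C₂ ⊆ 𝒰¹_∞` be closed `Γ_F`-stable subgroups, `I_j := φ_ε(Col_Σ C_j) ≤ Λ = 𝒪_F⟦X⟧⟦T⟧`, `2` prime in `Λ`,
`ε² = 1`, and `J₁, J₂ ≤ Λ` ideals with `Λ/J₁`, `Λ/J₂` pseudo-null.  If `J₁·I₁ ⊆ I₂` and `(2^k)·J₂·I₂ ⊆ I₁`, then
**`∃ i i′, char_Λ((N_Σ/Col_Σ C₂)_ε)·(2)^i = char_Λ((N_Σ/Col_Σ C₁)_ε)·(2)^{i′}`** (both sides are `char_Λ(Λ/I_j)`, then the generic ideal sandwich).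
[cite: deShalit1987, III §1.4 (5), §1.8 (14)–(15), Lemma 1.10 (17)] [cite: Washington1997, §13.2] [cite: BourbakiAC5to7, Ch. VII §4 no. 5 Prop. 10–11] -/
theorem exists_charIdeal_coinvariants_colemanImageTrace_mul_span_two_pow_eq_of_ideal_sandwich (ε : PowerSeries (PowerSeries 𝒪[F])) (hε : ε * ε = 1)
    (h2 : Prime (2 : PowerSeries (PowerSeries 𝒪[F]))) (J₁ J₂ : Ideal (PowerSeries (PowerSeries 𝒪[F]))) (k : ℕ)
    (hJ₁ : Module.IsPseudoNull (PowerSeries (PowerSeries 𝒪[F])) (PowerSeries (PowerSeries 𝒪[F]) ⧸ J₁))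
    (hJ₂ : Module.IsPseudoNull (PowerSeries (PowerSeries 𝒪[F])) (PowerSeries (PowerSeries 𝒪[F]) ⧸ J₂))
    (h₁ : J₁ * (colemanImageTrace hd hπ E hmono hE hdeg hσ₀ hq u hu γ hθ hcoh hN C₁ hC₁ hC₁sub h1₁ hmul₁ hinv₁ hgal₁).map
        (colemanDeltaCoinvFun hπ hq (intBase F) u hu γ (eq_zero_of_C_pi_mul_eq_zero_integer hπ) w hγ ε) ≤
      (colemanImageTrace hd hπ E hmono hE hdeg hσ₀ hq u hu γ hθ hcoh hN C₂ hC₂ hC₂sub h1₂ hmul₂ hinv₂ hgal₂).map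
        (colemanDeltaCoinvFun hπ hq (intBase F) u hu γ (eq_zero_of_C_pi_mul_eq_zero_integer hπ) w hγ ε))
    (h₂ : Ideal.span {(2 : PowerSeries (PowerSeries 𝒪[F])) ^ k} * J₂ *
        (colemanImageTrace hd hπ E hmono hE hdeg hσ₀ hq u hu γ hθ hcoh hN C₂ hC₂ hC₂sub h1₂ hmul₂ hinv₂ hgal₂).map
        (colemanDeltaCoinvFun hπ hq (intBase F) u hu γ (eq_zero_of_C_pi_mul_eq_zero_integer hπ) w hγ ε) ≤
      (colemanImageTrace hd hπ E hmono hE hdeg hσ₀ hq u hu γ hθ hcoh hN C₁ hC₁ hC₁sub h1₁ hmul₁ hinv₁ hgal₁).map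
        (colemanDeltaCoinvFun hπ hq (intBase F) u hu γ (eq_zero_of_C_pi_mul_eq_zero_integer hπ) w hγ ε)) :
    ∃ i i' : ℕ,
      Module.charIdeal (PowerSeries (PowerSeries 𝒪[F]))
          (↥(unitsImageTrace hd hπ E hmono hE hdeg hσ₀ hq u hu γ hθ hcoh hI hud) ⧸
            colemanCoinvRel hπ hq (intBase F) u hu γ ε (unitsImageTrace hd hπ E hmono hE hdeg hσ₀ hq u hu γ hθ hcoh hI hud)
              (fun _ hG => unitTwistₗ_mem_unitsImageTrace hd hπ E hmono hE hdeg hσ₀ hq u hu γ hθ hcoh hI hud (-1) hG)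
              (colemanImageTrace hd hπ E hmono hE hdeg hσ₀ hq u hu γ hθ hcoh hN C₂ hC₂ hC₂sub h1₂ hmul₂ hinv₂ hgal₂)) *
        Ideal.span {(2 : PowerSeries (PowerSeries 𝒪[F]))} ^ i =
      Module.charIdeal (PowerSeries (PowerSeries 𝒪[F]))
          (↥(unitsImageTrace hd hπ E hmono hE hdeg hσ₀ hq u hu γ hθ hcoh hI hud) ⧸
            colemanCoinvRel hπ hq (intBase F) u hu γ ε (unitsImageTrace hd hπ E hmono hE hdeg hσ₀ hq u hu γ hθ hcoh hI hud)
              (fun _ hG => unitTwistₗ_mem_unitsImageTrace hd hπ E hmono hE hdeg hσ₀ hq u hu γ hθ hcoh hI hud (-1) hG)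
              (colemanImageTrace hd hπ E hmono hE hdeg hσ₀ hq u hu γ hθ hcoh hN C₁ hC₁ hC₁sub h1₁ hmul₁ hinv₁ hgal₁)) *
        Ideal.span {(2 : PowerSeries (PowerSeries 𝒪[F]))} ^ i' := by
  rw [charIdeal_coinvariants_colemanImageTrace_eq hd hπ E hmono hE hdeg hσ₀ hq u hu γ w hγ hθ hcoh hI hud hm hN C₂ hC₂ hC₂sub h1₂ hmul₂ hinv₂ hgal₂ ε hε,
    charIdeal_coinvariants_colemanImageTrace_eq hd hπ E hmono hE hdeg hσ₀ hq u hu γ w hγ hθ hcoh hI hud hm hN C₁ hC₁ hC₁sub h1₁ hmul₁ hinv₁ hgal₁ ε hε]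
  exact Module.exists_charIdeal_quotient_mul_span_pow_eq_of_ideal_sandwich _ _ J₁ J₂ k h2 hJ₁ hJ₂ h₁ h₂

end Summit.BirchSwinnertonDyer.BirchSwinnertonDyer.Theorems.PrintCf2.ColemanCoinvariantTraceSandwich

end
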